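import Mathlib
import Summits.Ventures.PercRepro2.TwoHullMasterBlocksRigid
import Summits.Ventures.PercRepro2.TwoHullMasterBlockCheck
import Summits.Ventures.PercRepro2.SwAllCheck

/-!
# A kernel-checked certificate for the RIGID (MM) on an explicit graph (blind cell PercRepro2,
night-4 g40, 2026-08-29; proofs/NIGHT4-G40.md §6)

The rigid analogue of TwoHullMasterBlockCheck.lean: the blocks are the same `(base, classes)`
lists, but along a block the EDGE pair of `h` — the red edges inside its red cluster
(g38's `redInsideMask`), the blue edges inside its blue cluster — must be antitone (`pairLEE`,
inclusions on the low `m` bits), and the antipode must mirror the hull pair of `l` or the edge pair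
of `h` (`mirrorEqE`).  **`twoHullMasterRigid_of_checkCoverRigid`**: a certificate accepted by
`checkCoverRigid` gives `TwoHullMasterRigid (endsOf es) l h`, hence the rigid row 2′SW-ALL for
every mark (`swAll_of_twoHullMasterRigid`); TwoHullMasterPrismRigid.lean checks the prism.
-/

namespace Summit.Ventures.PercRepro2

namespace BlockCheckRigid

open Hull LocRows Path2 Glue2 Blocks SwCheck BlockCheck

variable {n : ℕ}

/-! ## §3 The rigid checks -/

/-- The mask of the red edges inside the red cluster of `v`. -/
def eMaskR (es : List (Fin n × Fin n)) (ω : ℕ) (v : Fin n) : ℕ := redInsideMask es ω v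

/-- The mask of the blue edges inside the blue cluster of `v`. -/
def eMaskB (es : List (Fin n × Fin n)) (ω : ℕ) (v : Fin n) : ℕ :=
  redInsideMask es (blueMask es.length ω) v

/-- The edge pair of `v` at `ω` lies below the one at `ω'`. -/
def pairLEE (es : List (Fin n × Fin n)) (ω ω' : ℕ) (v : Fin n) : Bool :=
  subMask es.length (eMaskR es ω v) (eMaskR es ω' v) &&
    subMask es.length (eMaskB es ω' v) (eMaskB es ω v)

/-- The edge pair of `v` at `ω'` is the swap of the one at `ω`. -/
def mirrorEqE (es : List (Fin n × Fin n)) (ω ω' : ℕ) (v : Fin n) : Bool :=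
  (eMaskR es ω' v == eMaskB es ω v) && (eMaskB es ω' v == eMaskR es ω v)

/-- The rigid checks on one block. -/
def checkBlockRigid (es : List (Fin n × Fin n)) (l h : Fin n) (b : ℕ × List ℕ) : Bool :=
  decide (b.1 < 2 ^ es.length) && b.2.all (fun c => decide (c < 2 ^ es.length)) &&
  (List.range (2 ^ b.2.length)).all (fun s => inU es l h (ptMask b.1 b.2 s)) &&
  (List.range (2 ^ b.2.length)).all (fun s => (List.range (2 ^ b.2.length)).all (fun s' =>
    !((s &&& s') == s) ||
      (pairLE es (ptMask b.1 b.2 s) (ptMask b.1 b.2 s') l &&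
        pairLEE es (ptMask b.1 b.2 s') (ptMask b.1 b.2 s) h))) &&
  ((List.range (2 ^ b.2.length)).all (fun s =>
      mirrorEq es (ptMask b.1 b.2 s) (ptMask b.1 b.2 (blueMask b.2.length s)) l) ||
    (List.range (2 ^ b.2.length)).all (fun s =>
      mirrorEqE es (ptMask b.1 b.2 s) (ptMask b.1 b.2 (blueMask b.2.length s)) h))

/-- **The rigid checker.** -/
def checkCoverRigid (es : List (Fin n × Fin n)) (l h : Fin n) (blocks : List (ℕ × List ℕ)) :
    Bool :=
  blocks.all (checkBlockRigid es l h) &&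
  (List.range (2 ^ es.length)).all (fun ω => !inU es l h ω ||
    blocks.any (fun b => (List.range (2 ^ b.2.length)).any (fun s => ptMask b.1 b.2 s == ω))) &&
  (List.range blocks.length).all (fun i => (List.range blocks.length).all (fun i' =>
    (List.range (2 ^ (blocks.getD i (0, [])).2.length)).all (fun s =>
      (List.range (2 ^ (blocks.getD i' (0, [])).2.length)).all (fun s' =>
        (decide (i = i') && decide (s = s')) ||
          !(ptMask (blocks.getD i (0, [])).1 (blocks.getD i (0, [])).2 s ==
            ptMask (blocks.getD i' (0, [])).1 (blocks.getD i' (0, [])).2 s')))))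

/-! ## §4 What the rigid checks guarantee -/

/-- The red edge mask is the set of red edges of `v`. -/
lemma eMaskR_testBit_iff (es : List (Fin n × Fin n)) (ω : ℕ) (v : Fin n) (e : Fin es.length) :
    (eMaskR es ω v).testBit e.val = true ↔ e ∈ redEdges (endsOf es) (toConfig es.length ω) v :=
  testBit_redInsideMask_iff es ω v e

/-- The blue edge mask is the set of blue edges of `v`. -/
lemma eMaskB_testBit_iff (es : List (Fin n × Fin n)) (ω : ℕ) (v : Fin n) (e : Fin es.length) :
    (eMaskB es ω v).testBit e.val = true ↔
      e ∈ blueEdges (endsOf es) (toConfig es.length ω) v := by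
  rw [eMaskB, testBit_redInsideMask_iff, toConfig_blueMask]
  rfl

/-- `pairLEE` gives the pair order of the edge pairs. -/
lemma pairLEE_spec (es : List (Fin n × Fin n)) {ω ω' : ℕ} {v : Fin n}
    (hp : pairLEE es ω ω' v = true) :
    PairLE (edgePair (endsOf es) (toConfig es.length ω) v)
      (edgePair (endsOf es) (toConfig es.length ω') v) := by
  simp only [pairLEE, Bool.and_eq_true] at hp
  refine ⟨fun x hx => ?_, fun x hx => ?_⟩
  · rw [edgePair] at hx ⊢
    rw [← eMaskR_testBit_iff] at hx ⊢
    exact subMask_spec hp.1 x hx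
  · rw [edgePair] at hx ⊢
    rw [← eMaskB_testBit_iff] at hx ⊢
    exact subMask_spec hp.2 x hx

/-- `mirrorEqE` gives the swapped edge pair. -/
lemma mirrorEqE_spec (es : List (Fin n × Fin n)) {ω ω' : ℕ} {v : Fin n}
    (hm : mirrorEqE es ω ω' v = true) :
    edgePair (endsOf es) (toConfig es.length ω') v =
      (edgePair (endsOf es) (toConfig es.length ω) v).swap := by
  simp only [mirrorEqE, Bool.and_eq_true, beq_iff_eq] at hm
  simp only [edgePair, Prod.swap]
  refine Prod.ext ?_ ?_
  · ext x
    rw [← eMaskR_testBit_iff, ← eMaskB_testBit_iff, hm.1]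
  · ext x
    rw [← eMaskB_testBit_iff, ← eMaskR_testBit_iff, hm.2]

/-! ## §5 The rigid cover -/

variable (es : List (Fin n × Fin n)) (l h : Fin n) (blocks : List (ℕ × List ℕ))

/-- The cube point of a block as a configuration. -/
noncomputable def ptR (b : Fin blocks.length) (ε : Fin (blocks.get b).2.length → Bool) :
    Config (Fin es.length) :=
  toConfig es.length (ptMask (blocks.get b).1 (blocks.get b).2 (encode ε))

/-- A block accepted by `checkBlockRigid` whose points are pairwise distinct is a rigid monotone cube
block. -/
lemma cubeBlockRigid_of_checkBlockRigid (b : Fin blocks.length)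
    (hb : checkBlockRigid es l h (blocks.get b) = true)
    (hdist : ∀ s, s < 2 ^ (blocks.get b).2.length → ∀ s', s' < 2 ^ (blocks.get b).2.length →
      s ≠ s' → ptMask (blocks.get b).1 (blocks.get b).2 s ≠ ptMask (blocks.get b).1 (blocks.get b).2 s') :
    CubeBlockRigid (endsOf es) l h (ptR es blocks b) := by
  simp only [checkBlockRigid, Bool.and_eq_true, decide_eq_true_eq, List.all_eq_true, List.mem_range,
    Bool.or_eq_true, Bool.not_eq_true'] at hb
  obtain ⟨⟨⟨⟨hbase, hcls⟩, hmem⟩, hmono⟩, hmirror⟩ := hb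
  have hlt : ∀ s, ptMask (blocks.get b).1 (blocks.get b).2 s < 2 ^ es.length :=
    fun s => ptMask_lt hbase (fun c hc => hcls c hc) s
  refine ⟨?_, ?_, ?_, ?_, ?_⟩
  · intro ε ε' hεε'
    have h1 := toConfig_inj (hlt _) (hlt _) hεε'
    have h2 : encode ε = encode ε' := by
      by_contra hne
      exact hdist _ (encode_spec ε).1 _ (encode_spec ε').1 hne h1
    rw [← (encode_spec ε).2, ← (encode_spec ε').2, h2]
  · intro ε
    exact (inU_iff es l h _).1 (hmem _ (encode_spec ε).1)
  · intro ε ε' hle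
    have := (hmono _ (encode_spec ε).1 _ (encode_spec ε').1).resolve_left
      (by simp [land_encode_of_le hle])
    exact pairLE_spec es this.1
  · intro ε ε' hle
    have := (hmono _ (encode_spec ε).1 _ (encode_spec ε').1).resolve_left
      (by simp [land_encode_of_le hle])
    exact pairLEE_spec es this.2
  · rcases hmirror with hm | hm
    · left
      intro ε
      have := mirrorEq_spec es (hm _ (encode_spec ε).1)
      simp only [ptR, encode_cubeNot]
      exact this
    · right
      intro ε
      have := mirrorEqE_spec es (hm _ (encode_spec ε).1)
      simp only [ptR, encode_cubeNot]
      exact this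

/-- **The rigid (MM) from a certificate.** -/
theorem twoHullMasterRigid_of_checkCoverRigid (hc : checkCoverRigid es l h blocks = true) :
    TwoHullMasterRigid (endsOf es) l h := by
  simp only [checkCoverRigid, Bool.and_eq_true, List.all_eq_true, List.mem_range, Bool.or_eq_true,
    Bool.not_eq_true', List.any_eq_true, beq_iff_eq, beq_eq_false_iff_ne, decide_eq_true_eq] at hc
  obtain ⟨⟨hblocks, hcover⟩, hdist⟩ := hc
  have hdist' : ∀ (b b' : Fin blocks.length) (s s' : ℕ), s < 2 ^ (blocks.get b).2.length →
      s' < 2 ^ (blocks.get b').2.length →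
      ptMask (blocks.get b).1 (blocks.get b).2 s = ptMask (blocks.get b').1 (blocks.get b').2 s' →
      b = b' ∧ s = s' := by
    intro b b' s s' hs hs' heq
    have := hdist b.val b.isLt b'.val b'.isLt s (by rwa [getD_eq_get]) s' (by rwa [getD_eq_get])
    rw [getD_eq_get, getD_eq_get] at this
    rcases this with ⟨hbb', hss'⟩ | hne
    · exact ⟨Fin.ext hbb', hss'⟩
    · exact absurd heq hne
  refine twoHullMasterRigid_of_cubeCoverRigid (β := Fin blocks.length)
    (ιb := fun b => Fin (blocks.get b).2.length) (ptb := ptR es blocks) ⟨?_, ?_, ?_⟩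
  · intro b
    refine cubeBlockRigid_of_checkBlockRigid es l h blocks b (hblocks _ (List.get_mem _ _)) ?_
    intro s hs s' hs' hne heq
    exact hne (hdist' b b s s' hs hs' heq).2
  · intro ζ hζ
    obtain ⟨ω, hω, rfl⟩ := exists_toConfig_eq es.length ζ
    have hU : inU es l h ω = true := (inU_iff es l h ω).2 hζ
    obtain ⟨bl, hbl, s, hs, hps⟩ := (hcover ω hω).resolve_left (by simp [hU])
    obtain ⟨b, rfl⟩ := List.mem_iff_get.1 hbl
    refine ⟨b, toConfig _ s, ?_⟩
    simp only [ptR, encode_toConfig hs, hps]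
  · intro b b' ε ε' heq
    have hlt : ∀ (b : Fin blocks.length) s,
        ptMask (blocks.get b).1 (blocks.get b).2 s < 2 ^ es.length := by
      intro b s
      have hb := hblocks _ (List.get_mem blocks b)
      simp only [checkBlockRigid, Bool.and_eq_true, decide_eq_true_eq, List.all_eq_true] at hb
      exact ptMask_lt hb.1.1.1.1 (fun c hc => hb.1.1.1.2 c hc) s
    have h1 := toConfig_inj (hlt b _) (hlt b' _) heq
    exact (hdist' b b' _ _ (encode_spec ε).1 (encode_spec ε').1 h1).1

end BlockCheckRigid

end Summit.Ventures.PercRepro2
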